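import Mathlib
import Summits.Ventures.HodgeRepro2.T6N1Obstruction
import Summits.Ventures.HodgeRepro2.T6NAut2

/-!
# T6N1Obstruction2 — the obstruction on the v2 carrier `NAut2` (STATUS ll. 11204 / 11210 / 11217; owner t6-p1)

The v2 carrier `NAut2 F P` (T6NAut2, the declared M2 v4 object) restricts the richness field to the N2
datum's admissible sets: `data_adm : d2.Adm → ∀ φ, d2.AdmData φ → ∃ c, AdmChoice c ∧ data c = φ`. The
obstruction of `T6N1Obstruction` transfers as soon as the admissible set `admA` of the line `111` is closed
under ℂ-scaling (every ℂ-subspace is; so is `Set.univ`, the admissible set of t6-p5's toy datum `toyIsoF`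
that the M2 v4 joint toy `toyM = NAut2.ofNAut (NAutToyN.toy …) (toyIsoF …)` carries): under `d2.Adm`, with
one admissible quadruple of non-zero pairing, the four N1 displays on `M.d1` are jointly false
(`nAut2_displays_false_of_admA_smul_closed`). For `NAut2.ofNAut M₁ d2` the N1 datum is `M₁.d1` and the v1
results apply verbatim (`ofNAut_displays_false_of_I_ne_zero`). An `NAut2` whose `admA` is NOT
scaling-closed (normalised Schwartz data) is not touched by this file — that is the repair named on the
bus. No `sorry`; standard axioms. §8(d): uses an L-value-free non-vanishing device: NO.
-/

namespace Summit.Ventures.HodgeRepro2.T6.N1Obstruction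

open scoped InnerProductSpace

variable {K : Type} [Field K] [NumberField K] [NumberField.IsCMField K]

/-- THE OBSTRUCTION ON THE v2 CARRIER: under the N2 datum-level admissibility, if the admissible set of
the line `111` is closed under ℂ-scaling and some admissible quadruple has a non-zero pairing, the four N1
displays on `M.d1` are jointly false. -/
theorem nAut2_displays_false_of_admA_smul_closed {F : FaceSetting K} {P : NDatum F} (M : NAut2 F P)
    (hN2 : M.AdmDatum) (hsmul : ∀ (t : ℂ) (φa : M.d3.A.Sa), φa ∈ M.d2.admA → t • φa ∈ M.d2.admA)
    (hv : ∃ (φa : M.d3.A.Sa) (φb : M.d3.A.Sb) (φc : M.d3.B.Sa) (φd : M.d3.B.Sb),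
      M.AdmData (φa, φb, φc, φd) ∧ ⟪M.d3.B.F φc φd, M.d3.A.F φa φb⟫_ℂ ≠ 0)
    (hH : Hyp.Voisin2002_7_3_2 M.d1) (hL : Hyp.Voisin2002_Lemma5_4_petersson M.d1)
    (hA : Hyp.Liu2021_Prop4_13_vertexLiftA M.d1) (hB : Hyp.Liu2021_Prop4_13_vertexLiftB M.d1) : False := by
  classical
  obtain ⟨φa, φb, φc, φd, hadm, hv⟩ := hv
  set E : HBC K := ExteriorAlgebra.ι ℂ (P.e P.τ₁ 0) * ExteriorAlgebra.ι ℂ (P.e P.τ₁ 1) *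
    ExteriorAlgebra.ι ℂ (P.e P.τ₁ 2) * ExteriorAlgebra.ι ℂ (P.e P.τ₁ 3) with hEdef
  set v : ℂ := ⟪M.d3.B.F φc φd, M.d3.A.F φa φb⟫_ℂ with hvdef
  have hcK : (M.d1.cK : ℂ) ≠ 0 := by exact_mod_cast M.d1.cK_pos.ne'
  set Λ : Set ℂ := Set.range fun q : Finset (Fin (Module.finrank ℚ (H1 K))) → ℚ =>
    ∑ t, (ToyN.bC K).ExteriorAlgebra.repr E t * (q t : ℂ) with hΛdef
  have hΛ : Λ.Countable := Set.countable_range _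
  set S : Set ℂ := Λ ∪ (fun x : ℂ => -x) '' Λ with hSdef
  have hS : S.Countable := hΛ.union (hΛ.image _)
  have key : ∀ t : ℂ, (M.d1.cK : ℂ) * (t * v) ∈ S := by
    intro t
    obtain ⟨c, hc, hdata⟩ := M.data_adm hN2 (t • φa) φb φc φd
      ⟨hsmul t φa hadm.1, hadm.2.1, hadm.2.2.1, hadm.2.2.2⟩
    have hpair : M.d1.pairing c = t * v := by
      simp [N1Datum.pairing, hdata, hvdef]
    have hI : P.I P.τ₁ c ∈ Λ := by
      obtain ⟨q, hq⟩ := intS_pull_eq_sum (P.shadow c) E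
      exact ⟨q, hq.symm⟩
    rcases N1Main.I_eq M.d1 hH hL hA hB c hc with h | h
    · exact Or.inl (by rw [← hpair, ← h]; exact hI)
    · exact Or.inr ⟨P.I P.τ₁ c, hI, by rw [h, hpair]; exact neg_neg _⟩
  have hinj : Function.Injective fun t : ℂ => (M.d1.cK : ℂ) * (t * v) := by
    intro a b h
    have h' : ((M.d1.cK : ℂ) * v) * a = ((M.d1.cK : ℂ) * v) * b := by
      simp only at h
      linear_combination h
    exact mul_left_cancel₀ (mul_ne_zero hcK hv) h'
  apply not_countable_complex
  refine (hS.preimage hinj).mono ?_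
  intro t _
  exact key t

/-- On `NAut2.ofNAut M₁ d2` (the v2 carrier built over a v1 one — the shape of the M2 v4 joint toy
`PeriodInput4Toy.toyM`) the N1 datum is `M₁.d1`: a v1 carrier with non-zero period at every admissible
choice gives a v2 carrier on which the four N1 displays are jointly false. -/
theorem ofNAut_displays_false_of_I_ne_zero {F : FaceSetting K} {P : NDatum F} (M₁ : NAut F P)
    (d2 : N2Datum F P M₁.d3) (hI : ∀ c, P.AdmChoice c → P.I P.τ₁ c ≠ 0)
    (hH : Hyp.Voisin2002_7_3_2 (NAut2.ofNAut M₁ d2).d1)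
    (hL : Hyp.Voisin2002_Lemma5_4_petersson (NAut2.ofNAut M₁ d2).d1)
    (hA : Hyp.Liu2021_Prop4_13_vertexLiftA (NAut2.ofNAut M₁ d2).d1)
    (hB : Hyp.Liu2021_Prop4_13_vertexLiftB (NAut2.ofNAut M₁ d2).d1) : False :=
  nAut_displays_false_of_I_ne_zero M₁ hI hH hL hA hB

end Summit.Ventures.HodgeRepro2.T6.N1Obstruction
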